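import Literature.AnabelianGeometry.SemiGraphs.CoveringGraphPointLift
import Literature.AnabelianGeometry.SemiGraphs.GraphCoveringFibres
import Literature.AnabelianGeometry.SemiGraphs.TemperedVerticialInjective
import HarnessLib

/-!
# [SemiAnbd] Rmk 3.5.1: the LOCALLY TRIVIAL object `S_π ∈ B^cov(G)` of a graph-covering `π : 𝔾′ → 𝔾` of the underlying
# semi-graph, and its covering semi-graph `𝔾_{S_π} ≅ 𝔾′` over `𝔾` (profinite presentation)

Mochizuki, *Semi-graphs of anabelioids*, Publ. RIMS **42** (2006), §3 Rmk 3.5.1 p. 37: «by passing to the underlying morphism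
of semi-graphs, one obtains an equivalence between the datum of a locally trivial covering of the semi-graph of anabelioids
`𝒢` and the datum of a graph-covering with countable fibers of the semi-graph `𝔾`»; §1 p. 14 (graph-coverings: proper
excisions), §2 p. 23 («the vertices … of `𝔾′` that lie over a vertex `v` … correspond to the connected components of `S_v`»),
Def 3.5 (i) p. 37 (kurims `paper:url-f33ace170ff4`). [cite: MochizukiSemiAnbd2006, Rmk 3.5.1 p.37]

abc-iut cell, layer L3, seat abc-iut-f-161 gen 8, row «PROP46⟸PULLBACK+P44i» stage 2 FILE C (the finite étale covering
`K′ → K` of print's proof of Prop 4.4 (i), p.55, IS the graph-covering of Thm 1.2 (ii) read back as a covering object).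
DEFINITIONS + kernel bookkeeping at abc-iut-L3-t2's profinite presentation, over abc-iut-L3-t1's branch bijections of a
graph-covering (`SemiGraph.Hom.fiberEquivOfBranch`, `GraphCoveringFibres`) and abc-iut-L3-t3's point lifts
(`CovObj.pointLift`, `CoveringGraphPointLift`):
* `BTemp.trivialOn Γ X` — the object of `B^temp(Γ)` on a countable set with TRIVIAL action (universe-polymorphic twin of
  abc-iut-w5-d…'s `IncoherentBouquet.trivialObj`, which is fixed at `Type`), `trivialOn_ρ`, orbits = points
  (`cl_trivialOn_injective`, `out_cl_trivialOn`);
* **`CovObj.ofGraphCovering π hπ h𝔾′`** for an excision `π : 𝔾′ → 𝔾_G` from a graph with countable fibres: vertex / edge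
  objects the FIBRES of `π` with trivial `Π_v` / `Π_e`-action, glued along a branch `b : e → v` by the branch bijection
  `π⁻¹(e) ≃ π⁻¹(v)` (`e′ ↦` the vertex at which the branch of `e′` over `b` abuts); `ofGraphCovering_isLocallyTrivial`,
  `ofGraphCovering_isFinite` (finite fibres), `ofGraphCovering_glue_apply`;
* the TAUTOLOGICAL point system of `π` itself (`y_w := ⟨w, rfl⟩ ∈ π⁻¹(π w)`): `ofGraphCovering_glueCondition` (along
  `b′ : e′ → w` the branch of `e′` over `π b′` is `b′`, so the glued point is `w`), the point lift
  `𝔾′ → 𝔾_{S_π}` is bijective on vertices and edges (`…_vertexMap_bijective` / `…_edgeMap_bijective`: orbits of a trivial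
  action are points), hence for PROPER `π` (graph-coverings) **`ofGraphCovering_graphIso : 𝔾′ ≅ 𝔾_{S_π}` over `𝔾_G`**
  (`ofGraphCovering_graphIso_hom_comp`).
Nothing printed is asserted; no side taken on [IUTchIII] Cor. 3.12.
-/

noncomputable section

namespace Literature.AnabelianGeometry.SemiGraphs

open CategoryTheory
open Literature.AlgebraicGeometry.Frobenioids.QuasiTemperoid.BTempConnected (hom_ρ ρ_one_apply
  ρ_mul_apply ρ_inv_apply)

universe u

/-! ## Objects of `B^temp(Γ)` with trivial action -/

section TrivialOn

variable (Γ : Type u) [Group Γ] [TopologicalSpace Γ]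

/-- The object of `B^temp(Γ)` on a countable set `X` with TRIVIAL `Γ`-action (universe-polymorphic; cf.
`IncoherentBouquet.trivialObj` at `Type`). [cite: MochizukiSemiAnbd2006, §3 p.33] -/
def BTemp.trivialOn (X : Type u) [Countable X] : BTemp Γ :=
  ⟨{ V := X, ρ := 1 }, ⟨inferInstance, fun x => by
    have : {g : Γ | ((1 : Γ →* End X) g : X ⟶ X) x = x} = Set.univ := Set.eq_univ_of_forall fun _ => rfl
    exact this ▸ isOpen_univ⟩⟩

/-- The trivial action is trivial. [cite: MochizukiSemiAnbd2006, §3 p.33] -/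
@[simp] theorem BTemp.trivialOn_ρ (X : Type u) [Countable X] (g : Γ) (x : X) :
    (BTemp.trivialOn Γ X).obj.ρ g x = x := rfl

/-- Orbits of a trivial action are points: equal classes have equal points. [cite: MochizukiSemiAnbd2006, §2 p.23] -/
theorem BTemp.cl_trivialOn_injective (X : Type u) [Countable X] {x y : X}
    (h : BTemp.cl (BTemp.trivialOn Γ X) x = BTemp.cl (BTemp.trivialOn Γ X) y) : x = y := by
  obtain ⟨g, hg⟩ := (BTemp.cl_eq_cl_iff _ _ _).mp h
  exact hg

/-- The chosen representative of the class of `x` is `x`. [cite: MochizukiSemiAnbd2006, §2 p.23] -/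
theorem BTemp.out_cl_trivialOn (X : Type u) [Countable X] (x : X) :
    Quot.out (BTemp.cl (BTemp.trivialOn Γ X) x) = x :=
  BTemp.cl_trivialOn_injective Γ X (Quot.out_eq (BTemp.cl (BTemp.trivialOn Γ X) x))

/-- Every element stabilises every point. [cite: MochizukiSemiAnbd2006, §3 p.33] -/
theorem BTemp.mem_stab_trivialOn (X : Type u) [Countable X] (x : X) (g : Γ) :
    g ∈ BTemp.stab (BTemp.trivialOn Γ X) x :=
  rfl

end TrivialOn

namespace ProfiniteSemiGraph

namespace CovObj

variable {K : ProfiniteSemiGraph.{u}} {B' : SemiGraph.{u}} (π : B' ⟶ K.graph) (hπ : SemiGraph.IsExcision π)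
  (hB' : B'.IsGraph) [∀ v, Countable (SemiGraph.Hom.VertexFiber π v)] [∀ e, Countable (SemiGraph.Hom.EdgeFiber π e)]

/-! ## The locally trivial covering object of a graph-covering (Rmk 3.5.1) -/

/-- **`S_π ∈ B^cov(G)` of an excision `π : 𝔾′ → 𝔾_G` from a graph** (Rmk 3.5.1): `S_v := π⁻¹(v)`, `S_e := π⁻¹(e)` with
TRIVIAL actions, glued along a branch `b : e → v` by the inverse branch bijection `π⁻¹(e) ≃ π⁻¹(v)` of §1 p.14
(`SemiGraph.Hom.fiberEquivOfBranch`: `e′ ↦` the vertex of `𝔾′` to which the branch of `e′` over `b` abuts).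
[cite: MochizukiSemiAnbd2006, Rmk 3.5.1 p.37] -/
def ofGraphCovering : CovObj K where
  SV v := BTemp.trivialOn (K.Gv v) (SemiGraph.Hom.VertexFiber π v)
  SE e := BTemp.trivialOn (K.Ge e) (SemiGraph.Hom.EdgeFiber π e)
  glue b v h := BTemp.isoOfEquiv (SemiGraph.Hom.fiberEquivOfBranch hπ hB' b v h).symm fun _ _ => rfl

/-- The vertex fibres of `S_π` are the fibres of `π`. [cite: MochizukiSemiAnbd2006, Rmk 3.5.1 p.37] -/
@[simp] theorem ofGraphCovering_SV (v : K.graph.Vertex) :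
    (ofGraphCovering π hπ hB').SV v = BTemp.trivialOn (K.Gv v) (SemiGraph.Hom.VertexFiber π v) := rfl

/-- The edge fibres of `S_π` are the fibres of `π`. [cite: MochizukiSemiAnbd2006, Rmk 3.5.1 p.37] -/
@[simp] theorem ofGraphCovering_SE (e : K.graph.Edge) :
    (ofGraphCovering π hπ hB').SE e = BTemp.trivialOn (K.Ge e) (SemiGraph.Hom.EdgeFiber π e) := rfl

/-- The gluing of `S_π` on points: `e′ ↦` the vertex receiving the branch of `e′` over `b`.
[cite: MochizukiSemiAnbd2006, Rmk 3.5.1 p.37] -/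
theorem ofGraphCovering_glue_apply (b : K.graph.Branch) (v : K.graph.Vertex) (h : K.graph.abuts b = some v)
    (x : SemiGraph.Hom.EdgeFiber π (K.graph.edgeOf b)) :
    ((ofGraphCovering π hπ hB').glue b v h).hom.hom.hom x = (SemiGraph.Hom.fiberEquivOfBranch hπ hB' b v h).symm x :=
  rfl

/-- **`S_π` is locally trivial** (all constituent actions trivial). [cite: MochizukiSemiAnbd2006, Rmk 3.5.1 p.37] -/
theorem ofGraphCovering_isLocallyTrivial : (ofGraphCovering π hπ hB').IsLocallyTrivial :=
  ⟨fun _ _ _ => rfl, fun _ _ _ => rfl⟩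

/-- `S_π` is a finite object when the fibres of `π` are finite. [cite: MochizukiSemiAnbd2006, §3 p.37] -/
theorem ofGraphCovering_isFinite (hV : ∀ v, Finite (SemiGraph.Hom.VertexFiber π v))
    (hE : ∀ e, Finite (SemiGraph.Hom.EdgeFiber π e)) : (ofGraphCovering π hπ hB').IsFinite :=
  ⟨fun v => hV v, fun e => hE e⟩

/-! ## The covering semi-graph of `S_π` is `𝔾′` -/

/-- Transport of a point of an edge fibre of `S_π` along an equality of edges keeps the underlying edge of `𝔾′`.
[cite: MochizukiSemiAnbd2006, Def 3.5(i) p.37] -/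
theorem ofGraphCovering_castPtE_val {e₁ e₂ : K.graph.Edge} (h : e₁ = e₂) (t : SemiGraph.Hom.EdgeFiber π e₁) :
    ((ofGraphCovering π hπ hB').castPtE h t).1 = t.1 := by
  subst h; rfl

omit [∀ v, Countable (SemiGraph.Hom.VertexFiber π v)] [∀ e, Countable (SemiGraph.Hom.EdgeFiber π e)] in
/-- In the graph `𝔾′`, the branch of `e(b′)` over `π b′` is `b′`, so the vertex it abuts to is the vertex `b′` abuts to.
[cite: MochizukiSemiAnbd2006, §1 p.11] -/
theorem vertexOver_eq_of_abuts (b' : B'.Branch) (w : B'.Vertex) (h' : B'.abuts b' = some w)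
    (x : SemiGraph.Hom.EdgeFiber π (K.graph.edgeOf (π.branchMap b'))) (hx : x.1 = B'.edgeOf b') :
    SemiGraph.Hom.vertexOver hB' (π.branchMap b') x = w := by
  have hb : SemiGraph.Hom.branchOver (π.branchMap b') x = b' :=
    SemiGraph.Hom.branch_eq_of_edgeOf_eq_of_branchMap_eq (ψ := π)
      (by rw [SemiGraph.Hom.edgeOf_branchOver, hx]) (by rw [SemiGraph.Hom.branchMap_branchOver])
  have h2 := SemiGraph.Hom.abuts_branchOver hB' (π.branchMap b') x
  rw [hb, h'] at h2
  exact (Option.some_injective _ h2).symm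

/-- **Gluing condition for the tautological point system of `π`** (`y_w := ⟨w, rfl⟩`, `z_{e′} := ⟨e′, rfl⟩`): along
`b′ : e′ → w` the gluing of `S_π` carries `z_{e′}` (transported over `π b′`) to `y_w` itself.
[cite: MochizukiSemiAnbd2006, Def 3.5(i) p.37] -/
theorem ofGraphCovering_glueCondition :
    (ofGraphCovering π hπ hB').GlueCondition π (fun w => ⟨w, rfl⟩) (fun e' => ⟨e', rfl⟩) := by
  refine ⟨fun b' w h' => ?_⟩
  congr 1
  rw [ofGraphCovering_glue_apply]
  apply Subtype.ext
  show SemiGraph.Hom.vertexOver hB' (π.branchMap b') _ = w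
  exact vertexOver_eq_of_abuts π hB' b' w h' _
    (by rw [ofGraphCovering_castPtE_val])

/-- The point lift `𝔾′ → 𝔾_{S_π}` is bijective on vertices (orbits of a trivial action are points).
[cite: MochizukiSemiAnbd2006, §2 p.23] -/
theorem ofGraphCovering_pointLift_vertexMap_bijective :
    Function.Bijective ((ofGraphCovering π hπ hB').pointLift π (fun w => ⟨w, rfl⟩) (fun e' => ⟨e', rfl⟩)
      (ofGraphCovering_glueCondition π hπ hB')).vertexMap := by
  constructor
  · intro w₁ w₂ h
    have := congrArg (fun ν : (ofGraphCovering π hπ hB').coveringSemiGraph.Vertex => (Quot.out ν.2).1) h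
    simpa only [pointLift_vertexMap, ofGraphCovering_SV, BTemp.out_cl_trivialOn] using this
  · rintro ⟨v, o⟩
    induction o using Quot.ind with
    | mk t =>
      obtain ⟨w, rfl⟩ := t
      exact ⟨w, rfl⟩

/-- … and on edges. [cite: MochizukiSemiAnbd2006, §2 p.23] -/
theorem ofGraphCovering_pointLift_edgeMap_bijective :
    Function.Bijective ((ofGraphCovering π hπ hB').pointLift π (fun w => ⟨w, rfl⟩) (fun e' => ⟨e', rfl⟩)
      (ofGraphCovering_glueCondition π hπ hB')).edgeMap := by
  constructor
  · intro e₁ e₂ h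
    have := congrArg (fun ε : (ofGraphCovering π hπ hB').coveringSemiGraph.Edge => (Quot.out ε.2).1) h
    simpa only [pointLift_edgeMap, ofGraphCovering_SE, BTemp.out_cl_trivialOn] using this
  · rintro ⟨e, o⟩
    induction o using Quot.ind with
    | mk t =>
      obtain ⟨e', rfl⟩ := t
      exact ⟨e', rfl⟩

/-- **`𝔾′ ≅ 𝔾_{S_π}`** for a PROPER excision from a graph (in particular a graph-covering): the point lift of the
tautological point system is an isomorphism of semi-graphs. [cite: MochizukiSemiAnbd2006, Rmk 3.5.1 p.37] -/
def ofGraphCovering_graphIso (hprop : SemiGraph.IsProper π) : B' ≅ (ofGraphCovering π hπ hB').coveringSemiGraph :=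
  (ofGraphCovering π hπ hB').pointLiftIso π (fun w => ⟨w, rfl⟩) (fun e' => ⟨e', rfl⟩)
    (ofGraphCovering_glueCondition π hπ hB') hprop (ofGraphCovering_pointLift_vertexMap_bijective π hπ hB')
    (ofGraphCovering_pointLift_edgeMap_bijective π hπ hB')

/-- The isomorphism `𝔾′ ≅ 𝔾_{S_π}` is the point lift. [cite: MochizukiSemiAnbd2006, Rmk 3.5.1 p.37] -/
@[simp] theorem ofGraphCovering_graphIso_hom (hprop : SemiGraph.IsProper π) :
    (ofGraphCovering_graphIso π hπ hB' hprop).hom =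
      (ofGraphCovering π hπ hB').pointLift π (fun w => ⟨w, rfl⟩) (fun e' => ⟨e', rfl⟩)
        (ofGraphCovering_glueCondition π hπ hB') :=
  rfl

/-- **`𝔾′ ≅ 𝔾_{S_π}` lies OVER `𝔾_G`**: composed with the structure morphism `𝔾_{S_π} → 𝔾_G` it is `π`.
[cite: MochizukiSemiAnbd2006, Rmk 3.5.1 p.37] -/
theorem ofGraphCovering_graphIso_hom_comp (hprop : SemiGraph.IsProper π) :
    (ofGraphCovering_graphIso π hπ hB' hprop).hom ≫
        (show (ofGraphCovering π hπ hB').coveringGraph.graph ⟶ K.graph from (ofGraphCovering π hπ hB').coveringHom.base) =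
      π :=
  (ofGraphCovering π hπ hB').pointLift_comp_base π _ _ (ofGraphCovering_glueCondition π hπ hB')

/-- On vertices the isomorphism is `w ↦ (π w, [⟨w⟩])`. [cite: MochizukiSemiAnbd2006, §2 p.23] -/
theorem ofGraphCovering_graphIso_hom_vertexMap (hprop : SemiGraph.IsProper π) (w : B'.Vertex) :
    (ofGraphCovering_graphIso π hπ hB' hprop).hom.vertexMap w =
      ⟨π.vertexMap w, BTemp.cl ((ofGraphCovering π hπ hB').SV (π.vertexMap w)) ⟨w, rfl⟩⟩ := rfl

/-- On edges the isomorphism is `e′ ↦ (π e′, [⟨e′⟩])`. [cite: MochizukiSemiAnbd2006, §2 p.23] -/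
theorem ofGraphCovering_graphIso_hom_edgeMap (hprop : SemiGraph.IsProper π) (e' : B'.Edge) :
    (ofGraphCovering_graphIso π hπ hB' hprop).hom.edgeMap e' =
      ⟨π.edgeMap e', BTemp.cl ((ofGraphCovering π hπ hB').SE (π.edgeMap e')) ⟨e', rfl⟩⟩ := rfl

end CovObj

end ProfiniteSemiGraph

end Literature.AnabelianGeometry.SemiGraphs

end
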